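import Mathlib
import Literature.NumberTheory.GaloisRepresentations.ArtinLFunction
import Literature.NumberTheory.GaloisRepresentations.ProjectiveType
import Literature.NumberTheory.GaloisRepresentations.EvenGaloisRep
import Literature.NumberTheory.GaloisRepresentations.ArtinConductor
import HarnessLib

/-!
# Even icosahedral Galois representations of prime conductor — Doud–Moore 2006 (named facts)

Two vendorings of the same paper live here: the REPRESENTATION-LEVEL statement
`DoudMoore2006_minimalPrimeConductor` (first landed by grounder g48-7 as p115812, 2026-08-16;
accidentally removed by the full-file proposal p115827 of grounder g48-10 which targeted the same
new path minutes later, and RESTORED below — statement re-typed from g48-7's grounding note on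
stmt-Langlands-15899, which records it verbatim as "(i) ∃ ρ : FramedArtinRep ℚ 2,
FramedGaloisRep.IsEven ρ ∧ IsIcosahedralType ρ.toMonoidHom ∧ GaloisRep.artinConductorNat
ρ.toGaloisRep = 1951; (ii) minimality among prime conductors"; g48-7 / librarians: please compare
with the p115812 text and sharpen the docstring if it differed) and the FIELD-LEVEL statement
`doudMoore2006_exists_totallyReal_A5_quintic_1951` (p115827).

# The totally real `A₅` quintic field of discriminant `1951⁴` — Doud–Moore 2006 (named fact)

D. Doud, M. W. Moore, *Even icosahedral Galois representations of prime conductor*,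
J. Number Theory 118 (2006) 62–70, doi:10.1016/j.jnt.2005.08.008 = arXiv:math/0405534 (held;
abstract, §2 and §4 read 2026-08-16). Abstract: "we use a series of targeted Hunter searches to
prove that the minimal prime conductor of an even icosahedral Galois representation is 1951. In
addition, we give a complete list of all even icosahedral Galois representations of prime
conductor less than 10,000." §2 (after Tate's lifting theorem and Serre's classification): an even
icosahedral representation of PRIME conductor `p` comes from a totally real `A₅` quintic field
`K`, and is of type 3a (`p ≡ 1 (mod 5)`, `d_K = p⁴`, `e_p = 5`), 3b (`p ≡ 1 (mod 3)`, `d_K = p²`,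
`e_p = 3`) or 3c (`p ≡ 1 (mod 4)`, `d_K = p²`, `e_p = 2`). §4 (Computational Results): "For each
prime congruent to 1 modulo 5 and below 10,000 we searched for an `A₅`-extension corresponding
to a representation of type 3a … We found a total of six primes `p` for which there exists an
even icosahedral Galois representation of conductor `p`. For each of these primes we list a
defining polynomial for the quintic field `K` … the minimal prime conductor of an even
icosahedral Galois representation is 1951"; the smallest primes of types 3b and 3c are `10267`
and `13613`. (`1951 = 5·390 + 1`, so the 1951 field is of type 3a: `d_K = 1951⁴ =
14488688572801`; the LMFDB records it as the field `5.5.14488688572801.1`, Galois group 5T4 = `A₅`,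
defining polynomial `x⁵ − x⁴ − 780x³ + 9911x² − 24208x + 15952`, ramified only at `1951` — quoted
for orientation; the fact below does not fix a polynomial.)

Recorded here is the FIELD-LEVEL content of the theorem (the computer search's output), in pure
Mathlib vocabulary: a totally real quintic number field of discriminant `1951⁴` in absolute value
whose Galois closure has group `A₅` (stated through the Galois group of the minimal polynomial of
a primitive element, `Polynomial.Gal`). The representation-level reading (two projective
representations `Γ_ℚ → PGL₂(ℂ)` with image `A₅`, lifted by Tate's theorem to EVEN icosahedral
representations of Artin conductor exactly `1951`, determinant of order 5) is theory on top of this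
input (Serre 1977 / Tate; Doud–Moore §2) and is what the consumer item assembles. The minimality
half of the theorem ("no even icosahedral representation of prime conductor `p < 1951`") is not
transcribed.

It grounds `Summit.Langlands.Langlands.Theses.QuarterDeficit1951.IcosahedralSupply`
(stmt-Langlands-15899; also the conductor-1951 hypotheses of `CorrespondentFingerprint`,
stmt-Langlands-15898): the existence of the Doud–Moore field is the one computational input of
that item that is not reasonably re-derivable in the kernel.

## References
* D. Doud, M. W. Moore, J. Number Theory 118 (2006) 62–70, abstract and §4 (Table). [DoudMoore2006]
* A. R. Booker, M. Lee, A. Strömbergsson, *Twist-minimal trace formulas and the Selberg eigenvalue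
  conjecture*, J. Lond. Math. Soc. 102 (2020), Thm. 2 (the list of even non-dihedral Artin
  representations of conductor ≤ 2862, conditional on Artin, starts at 1951). [BookerLeeStrombergsson2020]
* J.-P. Serre, *Modular forms of weight one and Galois representations* (1977), §8 (Tate's lifting).
-/

noncomputable section

namespace Literature.NumberTheory.GaloisRepresentations

/-- **Doud–Moore 2006, main theorem** (Abstract; §4 "Computational Results": "We found a total of
six primes `p` [below 10,000] for which there exists an even icosahedral Galois representation of
conductor `p` … the minimal prime conductor of an even icosahedral Galois representation is 1951";
"for primes `p` less than 10,000 and not included in this table, no even icosahedral Galois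
representation of conductor `p` can exist"). Representation-level form in the tree's vocabulary:
(i) there is a framed Artin representation `ρ : Γ_ℚ → GL₂(ℂ)` which is EVEN
(`FramedGaloisRep.IsEven`), of ICOSAHEDRAL TYPE (projective image `≅ A₅`, `IsIcosahedralType`)
and of Artin conductor `1951` (`GaloisRep.artinConductorNat`); (ii) no even icosahedral-type
`ρ : Γ_ℚ → GL₂(ℂ)` has Artin conductor a prime `p < 1951`. RESTORED declaration (see the module
docstring): first vendored by grounder g48-7 (p115812); this text is re-typed from that seat's
recorded statement and may differ cosmetically from the original. Grounds
`Summit.Langlands.Langlands.Theses.QuarterDeficit1951.IcosahedralSupply` (stmt-Langlands-15899).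
[cite: DoudMoore2006, Abstract and §4 (Computational Results, Table)] -/
def DoudMoore2006_minimalPrimeConductor : Prop :=
  (∃ ρ : FramedArtinRep ℚ 2, FramedGaloisRep.IsEven ρ ∧ IsIcosahedralType ρ.toMonoidHom ∧
      GaloisRep.artinConductorNat ρ.toGaloisRep = 1951) ∧
  ∀ p : ℕ, p.Prime → p < 1951 →
    ¬ ∃ ρ : FramedArtinRep ℚ 2, FramedGaloisRep.IsEven ρ ∧ IsIcosahedralType ρ.toMonoidHom ∧
      GaloisRep.artinConductorNat ρ.toGaloisRep = p

/-- **Doud–Moore 2006** (abstract and §4, Table, row `p = 1951`): there is a totally real number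
field `K` of degree `5` over `ℚ` with `|d_K| = 1951⁴` whose Galois closure has Galois group `A₅`
— i.e. `K = ℚ(θ)` for some `θ` whose (quintic) minimal polynomial over `ℚ` has Galois group
isomorphic to the alternating group on five letters. This is the quintic field behind the even
icosahedral Artin representations of minimal prime conductor `1951` (type 3a: `1951 ≡ 1 mod 5`,
totally ramified with `e = 5`). Grounds
`Summit.Langlands.Langlands.Theses.QuarterDeficit1951.IcosahedralSupply`.
[cite: DoudMoore2006, §4 (Computational Results, Table: p = 1951) and Abstract] -/
def doudMoore2006_exists_totallyReal_A5_quintic_1951 : Prop :=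
  ∃ (K : Type) (_ : Field K) (_ : NumberField K),
    Module.finrank ℚ K = 5 ∧ NumberField.IsTotallyReal K ∧
    (NumberField.discr K).natAbs = 1951 ^ 4 ∧
    ∃ θ : K, (minpoly ℚ θ).natDegree = 5 ∧
      Nonempty ((minpoly ℚ θ).Gal ≃* alternatingGroup (Fin 5))

/-! ## The TYPE of the conductor-`1951` representation: Doud–Moore type 3a (`e₁₉₅₁ = 5`)

Appended 2026-08-16 (literature-prover, wi-35331). The two facts above record EXISTENCE
(representation level, field level); they do not record the printed ramification TYPE at `1951`,
and conductor `1951` alone does not determine it at the level of the `Prop`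
(`1951 ≡ 1 (mod 3)` and `1951 ≡ 1 (mod 5)`). The paper prints it:

* §2 (Vignéras' classification, as restated by Doud–Moore; `E` = fixed field of the kernel of the
  projective representation `ρ̃ = π ∘ ρ`, `e_p` = ramification index of `p` in `E/ℚ`): "the
  irreducible even Galois representations `ρ` with prime conductor `p` are either dihedral or
  correspond to field extensions `E/ℚ` satisfying … 3a. `Gal(E/ℚ) ≅ A₅`, `p ≡ 1 (mod 5)`, `E/ℚ` is
  the normal closure of a quintic field of discriminant `p⁴`, and `e_p = 5`, 3b. `Gal(E/ℚ) ≅ A₅`,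
  `p ≡ 1 (mod 3)`, … discriminant `p²`, and `e_p = 3`, 3c. `Gal(E/ℚ) ≅ A₅`, `p ≡ 1 (mod 4)`, …
  discriminant `p²`, and `e_p = 2`."
* §3.2: "Type 3a: Here `p ≡ 1 (mod 5)` is ramified with `e = 5` [in the quintic field `K`]. Hence,
  the desired polynomial is of the form `(x − a)⁵ (mod p)`."
* §4: "For each prime congruent to 1 modulo 5 and below 10,000 we searched for an `A₅`-extension
  corresponding to a representation of type 3a. The results of our search are summarized in
  [the] table … From the table, we see that the minimal prime conductor of an even icosahedral
  Galois representation is 1951"; and "the smallest prime `p` for which there is a representation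
  of type 3b is `p = 10,267`, and the smallest prime `p` for which there is a representation of
  type 3c is `p = 13,613`."

Hence the even icosahedral representation(s) of conductor `1951` found by the search are of type
3a, and indeed EVERY even icosahedral representation of conductor `1951` is (types 3b, 3c start
above `10⁴`): `e₁₉₅₁(E/ℚ) = 5`, and `1951` is totally ramified (`e = 5`) in the quintic field `K`.

Tree reading of `e₁₉₅₁(E/ℚ) = 5` (representation level). `ρ̃` identifies `Gal(E/ℚ)` with the
projective image `ρ̃(Γ_ℚ) ≤ PGL₂(ℂ)`; under this identification the inertia group of `E/ℚ` at the
prime of `E` below a prime `𝔓` of `ℤ̄` over `1951` is the image `ρ̃(I_𝔓)` of the absolute inertia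
group `I_𝔓 = 𝔓.inertia Γ_ℚ` (inertia groups map onto inertia groups of Galois subextensions:
Serre, *Corps locaux*, Ch. I §7, Prop. 22), and its order is the ramification index (Neukirch,
*Algebraic Number Theory*, Ch. I (9.6)). So the printed `e₁₉₅₁ = 5` is recorded as
`Nat.card (ρ̃(I_𝔓)) = 5` for every prime `𝔓` of `ℤ̄ = absIntegers (𝓞 ℚ) ℚ` above the place `1951`
(`IsDedekindDomain.HeightOneSpectrum.primesAbove`), `ρ̃ = Matrix.ProjGenLinGroup.mk ∘ ρ`.
The consumers' form "some `σ ∈ I_𝔓` has `ρ̃(σ)` of order exactly `5`" is the proved corollary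
`DoudMoore2006_conductor1951_type3a.exists_inertia_orderOf_eq_five` (Cauchy). How consumers pass
from here to `det ρ|_{I₁₉₅₁}` of order `5`: at a prime of conductor exponent `1` the inertia acts
through `1 ⊕ η` and `η(I) → ρ̃(I)` is an isomorphism (Booker–Lee–Strömbergsson 2020, §4, proof of
the lemma on the orders of the local characters `χ_p`); that step is theirs, not part of this fact.
-/

section TypeThreeA

open scoped NumberField MatrixGroups
open IsDedekindDomain Field

/-- **Doud–Moore 2006, §2 (type 3a) with §4 (Table, row `p = 1951`; minimal primes of types 3b and
3c are `10267` and `13613`)**: there is an even (`FramedGaloisRep.IsEven`) icosahedral-type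
(`IsIcosahedralType`) Artin representation `ρ : Γ_ℚ → GL₂(ℂ)` of Artin conductor `1951` which is of
TYPE 3a at `1951`, i.e. `e₁₉₅₁(E/ℚ) = 5` for the `A₅`-field `E` cut out by `ρ̃`: for every prime `𝔓`
of `ℤ̄` above the place of `ℚ` dividing `1951`, the image of the inertia group `I_𝔓 ≤ Γ_ℚ` in
`PGL₂(ℂ)` has exactly `5` elements. Sharpens (the existence half of)
`DoudMoore2006_minimalPrimeConductor`, which omits the type. Requested by the crux cards
`iota-transport-open-kernel` / `discrete-tate-lift-padic` on
`Summit.Langlands.Langlands.Theses.QuarterDeficit1951.IcosahedralSupply` (stmt-Langlands-15899),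
whose clause `orderOf χ₀ = 5` is not derivable from conductor `1951` alone.
[cite: DoudMoore2006, §2 (classification, type 3a: e_p = 5, d_K = p^4) and §4 (Computational Results: Table, row p = 1951; minimal primes 10267 of type 3b and 13613 of type 3c)] -/
def DoudMoore2006_conductor1951_type3a : Prop :=
  ∃ ρ : FramedArtinRep ℚ 2, FramedGaloisRep.IsEven ρ ∧ IsIcosahedralType ρ.toMonoidHom ∧
    GaloisRep.artinConductorNat ρ.toGaloisRep = 1951 ∧
    ∀ v : HeightOneSpectrum (𝓞 ℚ), ((1951 : ℕ) : 𝓞 ℚ) ∈ v.asIdeal →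
      ∀ 𝔓 ∈ v.primesAbove,
        Nat.card ((𝔓.inertia (absoluteGaloisGroup ℚ)).map
          (Matrix.ProjGenLinGroup.mk.comp ρ.toMonoidHom)) = 5

/-- The consumers' reading of `DoudMoore2006_conductor1951_type3a` (the candidate text of
wi-35331, verbatim up to `∀ 𝔓`/`∃ 𝔓`): above the place `1951` there is a prime `𝔓` of `ℤ̄` and an
element `σ` of its inertia group whose image `ρ̃(σ) ∈ PGL₂(ℂ)` has order exactly `5`. Proof: a
prime above exists (`primesAbove_nonempty`) and a group of order `5` has an element of order `5`
(Cauchy, `exists_prime_orderOf_dvd_card'`). [cite: DoudMoore2006, §2 (type 3a) and §4 (Table, row p = 1951)] -/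
theorem DoudMoore2006_conductor1951_type3a.exists_inertia_orderOf_eq_five
    (h : DoudMoore2006_conductor1951_type3a) :
    ∃ ρ : FramedArtinRep ℚ 2, FramedGaloisRep.IsEven ρ ∧ IsIcosahedralType ρ.toMonoidHom ∧
      GaloisRep.artinConductorNat ρ.toGaloisRep = 1951 ∧
      ∀ v : HeightOneSpectrum (𝓞 ℚ), ((1951 : ℕ) : 𝓞 ℚ) ∈ v.asIdeal →
        ∃ 𝔓 ∈ v.primesAbove, ∃ σ ∈ 𝔓.inertia (absoluteGaloisGroup ℚ),
          orderOf (Matrix.ProjGenLinGroup.mk (ρ σ)) = 5 := by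
  obtain ⟨ρ, hev, hico, hcond, htype⟩ := h
  refine ⟨ρ, hev, hico, hcond, fun v hv => ?_⟩
  obtain ⟨𝔓, h𝔓⟩ := v.primesAbove_nonempty
  refine ⟨𝔓, h𝔓, ?_⟩
  have hcard := htype v hv 𝔓 h𝔓
  set H : Subgroup PGL(Fin 2, ℂ) :=
    (𝔓.inertia (absoluteGaloisGroup ℚ)).map (Matrix.ProjGenLinGroup.mk.comp ρ.toMonoidHom)
    with hH
  haveI : Finite H := Nat.finite_of_card_ne_zero (by rw [hcard]; norm_num)
  haveI : Fact (Nat.Prime 5) := ⟨by norm_num⟩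
  obtain ⟨x, hx⟩ := exists_prime_orderOf_dvd_card' (G := H) 5 (by rw [hcard])
  obtain ⟨σ, hσ, hσx⟩ := Subgroup.mem_map.mp x.2
  refine ⟨σ, hσ, ?_⟩
  have hx' : orderOf (x : PGL(Fin 2, ℂ)) = 5 := by rw [Subgroup.orderOf_coe]; exact hx
  simpa [← hσx] using hx'

/-- **Doud–Moore 2006, §3.2 ("Type 3a: here `p ≡ 1 (mod 5)` is ramified with `e = 5`") with §4
(Table, row `p = 1951`)** — field-level form of the type: there is a totally real quintic number
field `K` with `|d_K| = 1951⁴` whose Galois closure has group `A₅` (as in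
`doudMoore2006_exists_totallyReal_A5_quintic_1951`) in which `1951` is TOTALLY RAMIFIED: some
prime `P` of `𝓞 K` above `1951` has ramification index `e(P | 1951) = 5 = [K : ℚ]`
(Mathlib `Ideal.ramificationIdx`). Requested (field-level twin) by the crux card
`discrete-tate-lift-padic` on `QuarterDeficit1951.IcosahedralSupply` (stmt-Langlands-15899).
[cite: DoudMoore2006, §3.2 (Type 3a: e = 5) and §4 (Computational Results, Table, row p = 1951)] -/
def DoudMoore2006_quintic1951_totallyRamified : Prop :=
  ∃ (K : Type) (_ : Field K) (_ : NumberField K),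
    Module.finrank ℚ K = 5 ∧ NumberField.IsTotallyReal K ∧
    (NumberField.discr K).natAbs = 1951 ^ 4 ∧
    (∃ θ : K, (minpoly ℚ θ).natDegree = 5 ∧
      Nonempty ((minpoly ℚ θ).Gal ≃* alternatingGroup (Fin 5))) ∧
    ∃ P : Ideal (𝓞 K), P.IsPrime ∧
      P.comap (algebraMap ℤ (𝓞 K)) = Ideal.span {((1951 : ℕ) : ℤ)} ∧ P.ramificationIdx ℤ = 5

/-- The field-level type-3a fact contains the field-level existence fact
`doudMoore2006_exists_totallyReal_A5_quintic_1951` (drop the ramification clause). [folklore] -/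
theorem doudMoore2006_exists_totallyReal_A5_quintic_1951_of_totallyRamified
    (h : DoudMoore2006_quintic1951_totallyRamified) :
    doudMoore2006_exists_totallyReal_A5_quintic_1951 := by
  obtain ⟨K, _, _, hdeg, hreal, hdisc, hgal, -⟩ := h
  exact ⟨K, _, _, hdeg, hreal, hdisc, hgal⟩

/-- The representation-level type-3a fact contains the existence half of
`DoudMoore2006_minimalPrimeConductor` (drop the type clause). [folklore] -/
theorem DoudMoore2006_conductor1951_type3a.exists_even_icosahedral_conductor_1951
    (h : DoudMoore2006_conductor1951_type3a) :
    ∃ ρ : FramedArtinRep ℚ 2, FramedGaloisRep.IsEven ρ ∧ IsIcosahedralType ρ.toMonoidHom ∧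
      GaloisRep.artinConductorNat ρ.toGaloisRep = 1951 := by
  obtain ⟨ρ, hev, hico, hcond, -⟩ := h
  exact ⟨ρ, hev, hico, hcond⟩

end TypeThreeA

end Literature.NumberTheory.GaloisRepresentations

end
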